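import Summits.NavierStokesRegularity.NavierStokesRegularity.Theorems.AdaptedFrequencyAdaptedKernelExistsLowerOfUpperBridge

/-!
# Crux `AdaptedKernelExists` (stmt-NavierStokesRegularity-2956), line `nash-entropy-last-block`:
  `L¹`-smallness of far cylinders for STUB `stub_prekernelBounds`

Helper file (lands `--supports stmt-NavierStokesRegularity-2956`) for the registered stub
`stub_prekernelBounds` of the line's skeleton (positivity and the upper comparison for the smooth
representative `g` of `Γ + w`, `Γ = backwardHeatKernel ν T x₀`, `w ∈ L²(ℝ × E)`). The decay of
`g` at spatial infinity is obtained from Lieberman's local maximum principle, which bounds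
`|g(s, y)|` by the `L¹` norm of `g` on a parabolic cylinder around `(s, y)`; this file supplies the
smallness of those `L¹` norms far away from the pole, for a general finite-dimensional inner
product space `E`:

* `prekernel_heatKernel_le`: monotonicity of the Gauss–Weierstrass kernel in its age on a compact
  age interval (`G_σ ≤ (σ₂/σ₁)^{n/2} G_{σ₂}` for `σ ∈ [σ₁, σ₂]`);
* `prekernel_box_subst`: the reversed rescaled time `s = T⋆ − r/ν` in the box integrals
  (Fubini and the one-dimensional substitution `intervalIntegral.integral_comp_sub_div`):
  `∫_{(ν(T⋆−b′), ν(T⋆−a′)) × B(y, r)} |g(T⋆ − r/ν, x)| = ν ∫_{(a′, b′] × B(y, r)} |g|`;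
* `prekernel_box_small`: `∫_{(a′, b′] × B(y, r)} |g| → 0` as `‖y − x₀‖ → ∞` when `g = Γ + w`
  a.e. on the slab, `ta < a′`, `b′ < T`: a.e. `|g| ≤ Γ + |w| ≤ K Γ(a′, ·) + η′ + w²/(4η′)`, the
  majorant `K Γ(a′, ·) 1_{[a′, b′]} + w²/(4η′)` is integrable on `ℝ × E`, and its integrals over
  `{‖x − x₀‖ ≥ ρ}` tend to `0` (`tendsto_setIntegral_of_antitone`).

Its `ℝ³` form `stub_prekernelBounds_boxSmall` is a registered sub-goal of the crux item.
-/

noncomputable section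

open MeasureTheory Set Filter Topology Metric Function Real
open scoped Laplacian ContDiff
open Literature.Analysis.FluidPDE Literature.Analysis.UnboundedOperators

namespace Summit.NavierStokesRegularity.NavierStokesRegularity.Theorems.AdaptedKernelExists.NashEntropyLastBlock

section General

variable {E : Type*} [NormedAddCommGroup E] [InnerProductSpace ℝ E] [FiniteDimensional ℝ E]

omit [FiniteDimensional ℝ E] in
/-- **Monotonicity of the Gaussian in its age.** For `0 < σ₁ ≤ σ ≤ σ₂`:
`G_σ(z) ≤ (4πσ₁)^{-n/2} (4πσ₂)^{n/2} G_{σ₂}(z)` (the prefactor decreases, the exponential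
increases with the age). -/
theorem prekernel_heatKernel_le {σ₁ σ σ₂ : ℝ} (h₁ : 0 < σ₁) (h₁σ : σ₁ ≤ σ) (hσ₂ : σ ≤ σ₂)
    (z : E) :
    heatKernel σ z ≤ (4 * π * σ₁) ^ (-(Module.finrank ℝ E : ℝ) / 2) /
      (4 * π * σ₂) ^ (-(Module.finrank ℝ E : ℝ) / 2) * heatKernel σ₂ z := by
  have hσ : 0 < σ := h₁.trans_le h₁σ
  have hσ₂' : 0 < σ₂ := hσ.trans_le hσ₂
  have hn : -(Module.finrank ℝ E : ℝ) / 2 ≤ 0 := by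
    have : (0:ℝ) ≤ Module.finrank ℝ E := Nat.cast_nonneg _
    linarith
  have hc₂ : (4 * π * σ₂) ^ (-(Module.finrank ℝ E : ℝ) / 2) ≠ 0 :=
    (Real.rpow_pos_of_pos (by positivity) _).ne'
  unfold heatKernel
  rw [show (4 * π * σ₁) ^ (-(Module.finrank ℝ E : ℝ) / 2) /
      (4 * π * σ₂) ^ (-(Module.finrank ℝ E : ℝ) / 2) *
      ((4 * π * σ₂) ^ (-(Module.finrank ℝ E : ℝ) / 2) * Real.exp (-‖z‖ ^ 2 / (4 * σ₂))) =
      (4 * π * σ₁) ^ (-(Module.finrank ℝ E : ℝ) / 2) * Real.exp (-‖z‖ ^ 2 / (4 * σ₂)) by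
    field_simp]
  refine mul_le_mul ?_ ?_ (by positivity) (by positivity)
  · exact Real.rpow_le_rpow_of_nonpos (by positivity) (by nlinarith [Real.pi_pos]) hn
  · rw [Real.exp_le_exp, neg_div, neg_div, neg_le_neg_iff]
    exact div_le_div_of_nonneg_left (by positivity) (by positivity) (by linarith)

variable [MeasurableSpace E] [BorelSpace E]

/-- The volume of a box `(a′, b′] × B(y, r)` in `ℝ × E` does not depend on its centre `y`. -/
theorem prekernel_volume_box (a' b' r : ℝ) (y : E) :
    volume.real (Ioc a' b' ×ˢ ball y r) = volume.real (Ioc a' b') * volume.real (ball (0:E) r) := by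
  simp only [measureReal_def]
  rw [Measure.volume_eq_prod, Measure.prod_prod, Measure.addHaar_ball_center, ENNReal.toReal_mul]

/-- A function jointly smooth on the open slab `Ioo ta T × E` is absolutely integrable on the
boxes `(a′, b′] × B(y, r)`, `ta < a′`, `b′ < T` (continuity on the compact closure). -/
theorem prekernel_integrableOn_box {ta T a' b' r : ℝ} {g : ℝ → E → ℝ}
    (ha' : ta < a') (hb' : b' < T) (hg : IsSmoothSpaceTimeOn (Ioo ta T) g) (y : E) :
    IntegrableOn (fun p : ℝ × E => |g p.1 p.2|) (Ioc a' b' ×ˢ ball y r) := by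
  have hK : IsCompact (Icc a' b' ×ˢ closedBall y r) := isCompact_Icc.prod (isCompact_closedBall y r)
  have hKs : Icc a' b' ×ˢ closedBall y r ⊆ Ioo ta T ×ˢ univ :=
    prod_mono (fun s hs => ⟨ha'.trans_le hs.1, hs.2.trans_lt hb'⟩) (subset_univ _)
  exact IntegrableOn.mono_set ((hg.continuousOn.mono hKs).integrableOn_compact hK).abs
    (prod_mono Ioc_subset_Icc_self ball_subset_closedBall)

/-- The reversed rescaled function `(r, x) ↦ |g(T⋆ − r/ν, x)|` is integrable on the boxes
`(ν(T⋆ − b′), ν(T⋆ − a′)) × B(y, r)`, `ta < a′`, `b′ < T` (continuity on the compact closure). -/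
theorem prekernel_integrableOn_rev {ν ta T Ts a' b' r : ℝ} {g : ℝ → E → ℝ} (hν : 0 < ν)
    (ha' : ta < a') (hb' : b' < T) (hg : IsSmoothSpaceTimeOn (Ioo ta T) g) (y : E) :
    IntegrableOn (fun p : ℝ × E => |g (Ts - p.1 / ν) p.2|)
      (Ioo (ν * (Ts - b')) (ν * (Ts - a')) ×ˢ ball y r) := by
  have hK : IsCompact (Icc (ν * (Ts - b')) (ν * (Ts - a')) ×ˢ closedBall y r) :=
    isCompact_Icc.prod (isCompact_closedBall y r)
  have hmaps : MapsTo (fun p : ℝ × E => (Ts - p.1 / ν, p.2))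
      (Icc (ν * (Ts - b')) (ν * (Ts - a')) ×ˢ closedBall y r) (Ioo ta T ×ˢ univ) := by
    rintro ⟨ρ, x⟩ ⟨hρ, -⟩
    refine ⟨⟨?_, ?_⟩, mem_univ _⟩
    · have : ρ / ν ≤ Ts - a' := by rw [div_le_iff₀ hν]; linarith [hρ.2]
      show ta < Ts - ρ / ν
      linarith
    · have : Ts - b' ≤ ρ / ν := by rw [le_div_iff₀ hν]; linarith [hρ.1]
      show Ts - ρ / ν < T
      linarith
  have hmap : Continuous fun p : ℝ × E => (Ts - p.1 / ν, p.2) := by fun_prop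
  have hc : ContinuousOn (fun p : ℝ × E => g (Ts - p.1 / ν) p.2)
      (Icc (ν * (Ts - b')) (ν * (Ts - a')) ×ˢ closedBall y r) := by
    have h := hg.continuousOn.comp hmap.continuousOn hmaps
    exact h
  exact IntegrableOn.mono_set (hc.integrableOn_compact hK).abs
    (prod_mono Ioo_subset_Icc_self ball_subset_closedBall)

/-- **The reversed rescaled time in the box integrals.** With `s = T⋆ − r/ν` (Fubini twice and
the one-dimensional affine substitution):
`∫_{(ν(T⋆−b′), ν(T⋆−a′)) × B(y, r)} |g(T⋆ − r/ν, x)| d(r, x) = ν ∫_{(a′, b′] × B(y, r)} |g|`. -/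
theorem prekernel_box_subst {ν ta T Ts a' b' r : ℝ} {g : ℝ → E → ℝ} (hν : 0 < ν)
    (ha' : ta < a') (hab : a' ≤ b') (hb' : b' < T) (hg : IsSmoothSpaceTimeOn (Ioo ta T) g)
    (y : E) :
    ∫ p in Ioo (ν * (Ts - b')) (ν * (Ts - a')) ×ˢ ball y r, |g (Ts - p.1 / ν) p.2| =
      ν * ∫ p in Ioc a' b' ×ˢ ball y r, |g p.1 p.2| := by
  have hαβ : ν * (Ts - b') ≤ ν * (Ts - a') := mul_le_mul_of_nonneg_left (by linarith) hν.le
  have ha'e : Ts - ν * (Ts - a') / ν = a' := by field_simp; ring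
  have hb'e : Ts - ν * (Ts - b') / ν = b' := by field_simp; ring
  have hI1 := prekernel_integrableOn_rev (Ts := Ts) (r := r) hν ha' hb' hg y
  have hI2 := prekernel_integrableOn_box (r := r) ha' hb' hg y
  calc ∫ p in Ioo (ν * (Ts - b')) (ν * (Ts - a')) ×ˢ ball y r, |g (Ts - p.1 / ν) p.2|
      = ∫ ρ in Ioo (ν * (Ts - b')) (ν * (Ts - a')), ∫ x in ball y r, |g (Ts - ρ / ν) x| :=
        setIntegral_prod (fun p : ℝ × E => |g (Ts - p.1 / ν) p.2|) hI1
    _ = ∫ ρ in (ν * (Ts - b'))..(ν * (Ts - a')), ∫ x in ball y r, |g (Ts - ρ / ν) x| := by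
        rw [intervalIntegral.integral_of_le hαβ, integral_Ioc_eq_integral_Ioo]
    _ = ν • ∫ s in (Ts - ν * (Ts - a') / ν)..(Ts - ν * (Ts - b') / ν),
          ∫ x in ball y r, |g s x| :=
        intervalIntegral.integral_comp_sub_div (fun s => ∫ x in ball y r, |g s x|) hν.ne' Ts
    _ = ν * ∫ s in Ioc a' b', ∫ x in ball y r, |g s x| := by
        rw [ha'e, hb'e, intervalIntegral.integral_of_le hab, smul_eq_mul]
    _ = ν * ∫ p in Ioc a' b' ×ˢ ball y r, |g p.1 p.2| := by
        congr 1
        exact (setIntegral_prod (fun p : ℝ × E => |g p.1 p.2|) hI2).symm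

/-- **`L¹`-smallness of far boxes.** Let `g` be jointly smooth on the open slab `Ioo ta T × E`
with `Γ + w = g` a.e. there, `Γ = backwardHeatKernel ν T x₀`, `w ∈ L²(ℝ × E)`, and let
`ta < a′`, `b′ < T`. Then `∫_{(a′, b′] × B(y, r)} |g| ≤ η` for all `y` far enough from `x₀`.
Proof: a.e. on the box `|g| ≤ Γ + |w| ≤ K Γ(a′, ·) + η′ + w²/(4η′)` (monotonicity of the
Gaussian in its age on `[a′, b′]`, `|w| ≤ η′ + w²/(4η′)`); the majorant
`H = K Γ(a′, ·) 1_{[a′, b′]} + w²/(4η′)` is integrable on `ℝ × E`, so `∫_{‖x − x₀‖ ≥ ρ} H → 0`,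
while `∫_{box} η′ = η′ · |box|` does not depend on `y`. -/
theorem prekernel_box_small {ν ta T a' b' r : ℝ} {x₀ : E} {w : ℝ × E → ℝ} {g : ℝ → E → ℝ}
    (hν : 0 < ν) (ha' : ta < a') (hab : a' ≤ b') (hb' : b' < T) (hw2 : MemLp w 2 volume)
    (hg : IsSmoothSpaceTimeOn (Ioo ta T) g)
    (hae : ∀ᵐ p : ℝ × E, p ∈ Ioo ta T ×ˢ univ →
      backwardHeatKernel ν T x₀ p.1 p.2 + w p = g p.1 p.2)
    {η : ℝ} (hη : 0 < η) :
    ∃ ρ₀ : ℝ, ∀ y, ρ₀ ≤ ‖y - x₀‖ → ∫ p in Ioc a' b' ×ˢ ball y r, |g p.1 p.2| ≤ η := by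
  -- the volume of the boxes and the parameter `η′`
  obtain ⟨V, hV⟩ : ∃ V : ℝ, V = volume.real (Ioc a' b') * volume.real (ball (0:E) r) := ⟨_, rfl⟩
  have hV0 : 0 ≤ V := by rw [hV]; exact mul_nonneg measureReal_nonneg measureReal_nonneg
  have hVy : ∀ y : E, volume.real (Ioc a' b' ×ˢ ball y r) = V := fun y => by
    rw [hV]; exact prekernel_volume_box a' b' r y
  obtain ⟨η', hη'⟩ : ∃ η' : ℝ, η' = η / (3 * (V + 1)) := ⟨_, rfl⟩
  have hη'0 : 0 < η' := by rw [hη']; positivity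
  have hη'V : η' * V ≤ η / 3 := by
    rw [hη', div_mul_eq_mul_div, div_le_div_iff₀ (by positivity) (by norm_num)]
    nlinarith
  -- the Gaussian majorant on `[a′, b′]`
  have hσ₁ : 0 < ν * (T - b') := mul_pos hν (by linarith)
  have hσ₂ : 0 < ν * (T - a') := mul_pos hν (by linarith)
  obtain ⟨K, hK⟩ : ∃ K : ℝ, K = (4 * π * (ν * (T - b'))) ^ (-(Module.finrank ℝ E : ℝ) / 2) /
      (4 * π * (ν * (T - a'))) ^ (-(Module.finrank ℝ E : ℝ) / 2) := ⟨_, rfl⟩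
  have hK0 : 0 ≤ K := by rw [hK]; positivity
  have hΓle : ∀ s ∈ Icc a' b', ∀ x,
      backwardHeatKernel ν T x₀ s x ≤ K * backwardHeatKernel ν T x₀ a' x := by
    intro s hs x
    rw [hK]
    exact prekernel_heatKernel_le hσ₁ (mul_le_mul_of_nonneg_left (by linarith [hs.2]) hν.le)
      (mul_le_mul_of_nonneg_left (by linarith [hs.1]) hν.le) _
  -- the integrable majorant `H`
  obtain ⟨H, hH⟩ : ∃ H : ℝ × E → ℝ, H = fun p =>
      (Icc a' b').indicator (fun _ => (1:ℝ)) p.1 * (K * backwardHeatKernel ν T x₀ a' p.2) +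
        w p ^ 2 / (4 * η') := ⟨_, rfl⟩
  have hHi : Integrable H := by
    rw [hH]
    refine Integrable.add ?_ ((hw2.integrable_sq).div_const _)
    have h1 : Integrable ((Icc a' b').indicator fun _ => (1:ℝ)) (volume : Measure ℝ) :=
      (integrable_indicator_iff measurableSet_Icc).2 (integrableOn_const measure_Icc_lt_top.ne)
    have h2 : Integrable (fun x : E => K * backwardHeatKernel ν T x₀ a' x) := by
      have := ((integrable_heatKernel_holds hσ₂).comp_sub_right x₀).const_mul K
      simpa only [backwardHeatKernel] using this
    exact h1.mul_prod h2
  have hH0 : ∀ p, 0 ≤ H p := fun p => by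
    rw [hH]
    exact add_nonneg (mul_nonneg (Set.indicator_nonneg (fun _ _ => zero_le_one) _)
      (mul_nonneg hK0 (heatKernel_pos hσ₂ _).le)) (div_nonneg (sq_nonneg _) (by positivity))
  -- the tails of `H`
  obtain ⟨S, hS⟩ : ∃ S : ℝ → Set (ℝ × E), S = fun ρ => {p | ρ ≤ ‖p.2 - x₀‖} := ⟨_, rfl⟩
  have hSmem : ∀ ρ (p : ℝ × E), p ∈ S ρ ↔ ρ ≤ ‖p.2 - x₀‖ := fun ρ p => by rw [hS]; rfl
  have hSm : ∀ ρ, MeasurableSet (S ρ) := fun ρ => by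
    rw [hS]
    exact (isClosed_le continuous_const (continuous_snd.sub continuous_const).norm).measurableSet
  have hSa : Antitone S := fun ρ₁ ρ₂ h p hp => by
    rw [hSmem] at hp ⊢
    exact h.trans hp
  have hSe : (⋂ ρ, S ρ) = ∅ := by
    refine eq_empty_of_forall_notMem fun p hp => ?_
    have := (hSmem _ p).1 (mem_iInter.1 hp (‖p.2 - x₀‖ + 1))
    linarith
  have hT : Tendsto (fun ρ => ∫ p in S ρ, H p) atTop (𝓝 0) := by
    have := tendsto_setIntegral_of_antitone hSm hSa ⟨0, hHi.integrableOn⟩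
    rwa [hSe, Measure.restrict_empty, integral_zero_measure] at this
  obtain ⟨ρ₁, hρ₁⟩ := eventually_atTop.1
    (Tendsto.eventually_le_const (show (0:ℝ) < η / 3 by positivity) hT)
  refine ⟨ρ₁ + r, fun y hy => ?_⟩
  -- the box at `y`
  have hbox_sub : Ioc a' b' ×ˢ ball y r ⊆ S ρ₁ := by
    rintro ⟨s, x⟩ ⟨-, hx⟩
    rw [hSmem]
    rw [mem_ball, dist_eq_norm] at hx
    have h1 := norm_sub_le_norm_sub_add_norm_sub y x x₀
    rw [← norm_neg (y - x), neg_sub] at h1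
    show ρ₁ ≤ ‖x - x₀‖
    linarith
  have hslab : Ioc a' b' ×ˢ ball y r ⊆ Ioo ta T ×ˢ univ :=
    prod_mono (fun s hs => ⟨ha'.trans hs.1, hs.2.trans_lt hb'⟩) (subset_univ _)
  have hmeas : MeasurableSet (Ioc a' b' ×ˢ ball y r) := measurableSet_Ioc.prod measurableSet_ball
  have hK2 : IsCompact (Icc a' b' ×ˢ closedBall y r) :=
    isCompact_Icc.prod (isCompact_closedBall y r)
  have hIg : IntegrableOn (fun p : ℝ × E => |g p.1 p.2|) (Ioc a' b' ×ˢ ball y r) :=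
    prekernel_integrableOn_box ha' hb' hg y
  have hfin : volume (Ioc a' b' ×ˢ ball y r) < ⊤ :=
    (measure_mono (Set.prod_mono Ioc_subset_Icc_self ball_subset_closedBall)).trans_lt
      hK2.measure_lt_top
  have hIH : IntegrableOn (fun p => H p + η') (Ioc a' b' ×ˢ ball y r) :=
    hHi.integrableOn.add (integrableOn_const hfin.ne)
  -- the a.e. bound `|g| ≤ H + η′` on the box
  have hae' : ∀ᵐ p ∂(volume.restrict (Ioc a' b' ×ˢ ball y r)), |g p.1 p.2| ≤ H p + η' := by
    rw [ae_restrict_iff' hmeas]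
    filter_upwards [hae] with p hp hpB
    have h1 := hp (hslab hpB)
    have hs : p.1 ∈ Icc a' b' := Ioc_subset_Icc_self hpB.1
    have hΓ0 : 0 < backwardHeatKernel ν T x₀ p.1 p.2 :=
      heatKernel_pos (mul_pos hν (by linarith [hs.2])) _
    have hAM : |w p| ≤ η' + w p ^ 2 / (4 * η') := by
      have key : (|w p| - η') * (4 * η') ≤ w p ^ 2 := by
        nlinarith [sq_nonneg (|w p| - 2 * η'), sq_abs (w p)]
      have := (le_div_iff₀ (show (0:ℝ) < 4 * η' by positivity)).2 key
      linarith
    rw [← h1, hH]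
    simp only [indicator_of_mem hs, one_mul]
    calc |backwardHeatKernel ν T x₀ p.1 p.2 + w p|
        ≤ |backwardHeatKernel ν T x₀ p.1 p.2| + |w p| := abs_add_le _ _
      _ = backwardHeatKernel ν T x₀ p.1 p.2 + |w p| := by rw [abs_of_pos hΓ0]
      _ ≤ K * backwardHeatKernel ν T x₀ a' p.2 + (η' + w p ^ 2 / (4 * η')) :=
          add_le_add (hΓle p.1 hs p.2) hAM
      _ = K * backwardHeatKernel ν T x₀ a' p.2 + w p ^ 2 / (4 * η') + η' := by ring
  -- assembling
  calc ∫ p in Ioc a' b' ×ˢ ball y r, |g p.1 p.2|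
      ≤ ∫ p in Ioc a' b' ×ˢ ball y r, (H p + η') := integral_mono_ae hIg hIH hae'
    _ = (∫ p in Ioc a' b' ×ˢ ball y r, H p) + η' * V := by
        rw [integral_add hHi.integrableOn (integrableOn_const hfin.ne), setIntegral_const, hVy,
          smul_eq_mul, mul_comm V]
    _ ≤ (∫ p in S ρ₁, H p) + η / 3 :=
        add_le_add (setIntegral_mono_set hHi.integrableOn (Eventually.of_forall fun p => hH0 p)
          hbox_sub.eventuallyLE) hη'V
    _ ≤ η / 3 + η / 3 := add_le_add (hρ₁ ρ₁ le_rfl) le_rfl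
    _ ≤ η := by linarith

end General

/-! ### The registered sub-goal (dimension three) -/

/-- **Registered sub-goal `stub_prekernelBounds_boxSmall`** (the `ℝ³` form of
`prekernel_box_small`, the `L¹`-smallness step of STUB `stub_prekernelBounds`): for `g` jointly
smooth on the open slab with `Γ + w = g` a.e. there, `w ∈ L²`, and `ta < a′ ≤ b′ < T`, the
integrals `∫_{(a′, b′] × B(y, r)} |g|` are `≤ η` for `y` far from the pole. -/
theorem stub_prekernelBounds_boxSmall :
    ∀ (ν ta T a' b' r : ℝ) (x₀ : EuclideanSpace ℝ (Fin 3)) (w : ℝ × EuclideanSpace ℝ (Fin 3) → ℝ) (g : ℝ → EuclideanSpace ℝ (Fin 3) → ℝ), 0 < ν → ta < a' → a' ≤ b' → b' < T → MemLp w 2 volume → IsSmoothSpaceTimeOn (Ioo ta T) g → (∀ᵐ p : ℝ × EuclideanSpace ℝ (Fin 3), p ∈ Ioo ta T ×ˢ univ → backwardHeatKernel ν T x₀ p.1 p.2 + w p = g p.1 p.2) → ∀ η : ℝ, 0 < η → ∃ ρ₀ : ℝ, ∀ y, ρ₀ ≤ ‖y - x₀‖ → ∫ p in Ioc a' b' ×ˢ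 ball y r, |g p.1 p.2| ≤ η :=
  fun _ _ _ _ _ _ _ _ _ hν ha' hab hb' hw2 hg hae _ hη => prekernel_box_small hν ha' hab hb' hw2 hg hae hη

end Summit.NavierStokesRegularity.NavierStokesRegularity.Theorems.AdaptedKernelExists.NashEntropyLastBlock

end
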